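import Summits.BirchSwinnertonDyer.BirchSwinnertonDyer.Theorems.AdditiveKolyvaginRoadRamifiedHabitatSignLawAsTyped
import Summits.BirchSwinnertonDyer.BirchSwinnertonDyer.Theorems.AdditiveKolyvaginRoadRamifiedHabitatSignLawEvenField
import HarnessLib

/-!
# Route `AdditiveKolyvaginRoad`, crux KS′ `LevelKolyvaginSystemsAdditive` (stmt-BirchSwinnertonDyer-21396), card
# `ramified-toric-habitat` — the card's two SIGN LAWS AS TYPED with NO PARITY BINDER on `d_{K′}`
# (`E` semistable away from `p`, modulo {Modularity, Kellock–Dokchitser Rem. 2.2 at `p`})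

Cell `pub/bsd-wall`, width seat `bsd-wall-akr-p2x-w3` g13; `--supports stmt-BirchSwinnertonDyer-21396` (helper).
THEOREMS ONLY; no definition, no named fact, no `sorry`. BSD is not proved by any of this; KS′/KPA′ stay OPEN
at `p² ∣ N`.

w3 g12's `…RamifiedHabitatSignLawAsTyped` proves the sketch's `RamifiedToricHabitat.SignLawSupercuspidal` /
`…SignLawPrincipalSeries` (`Cruxes/LevelKolyvaginSystemsAdditive/RamifiedHabitatKuriharaSlotSketch.lean` §1) with the
sketch's own binders (`Addv W p`, `¬ e ∣ p − 1` / `e ∣ p − 1` with `e := W.semistabilityDefectAt p`, `p ∣ d_{K′}`,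
`OtherBadPrimesSplit` unfolded) on `N = M p²` (`M` squarefree) for ODD `d_{K′}`. This file removes the parity restriction:

* §1 `rootNumber_mul_rootNumber_twist_discr_even_eq_one_of_not_semistabilityDefectAt_dvd` / `…_eq_neg_one_of_…_dvd` —
  the dichotomy with the sketch's binder on the six potentially good rows `a ∈ {2,3,4,8,9,10}` for `4 ∣ d_{K′}`
  (this seat's `…SignLawEven*`: the even coprime twist law through the Kronecker character mod `|D'|`, then the
  `p*`-level theorems of w2 g11/g12 verbatim);
* §2 `signLawSupercuspidal_of_addv_of_squarefree_of_four_dvd`, `signLawPrincipalSeries_of_addv_of_padicValRat_j_nonneg_of_squarefree_of_four_dvd`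
  — the AS-TYPED theorems for `4 ∣ d_{K′}`;
* §3 **`signLawSupercuspidal_of_addv_of_squarefree_allDiscr`**, **`signLawPrincipalSeries_of_addv_of_padicValRat_j_nonneg_of_squarefree_allDiscr`**
  — NO parity hypothesis on `d_{K′}` (a quadratic discriminant is odd or divisible by `4`,
  `Quadratic.isFundamentalDiscriminant_discr`): the card's FIRST LEMMA AS TYPED on `N = M p²`, `M` squarefree, for EVERY
  imaginary quadratic habitat `K′`, modulo {`hmod`, `hF1`, `hF1'`} — and, for the principal series, with the potentially good
  binder `0 ≤ ord_p j` that the sketch's Prop lacks (it is false on the potentially multiplicative rows, evidence #41).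

What remains between §3 and the sketch's Props verbatim: other additive primes of `E` (w2 g12's any-level lane; types II/III/IV
are already any-level in `…SignLawEven`), and the named facts.

References: [cite: Serre1972, §5.6 (p. 312)] [cite: Rohrlich1993Compositio, Prop. 2(iv)] [cite: KellockDokchitser2023, Rem. 2.2]
[cite: MurtyMurty1997, Ch. 6 §1].
-/

set_option autoImplicit false
set_option linter.dupNamespace false

noncomputable section

open scoped Classical NumberTheorySymbols

open IsDedekindDomain IsDedekindDomain.HeightOneSpectrum NumberField Rat.HeightOneSpectrum
  WeierstrassCurve Literature.NumberTheory.EllipticCurves Literature.NumberTheory.EllipticCurves.Rank1Residual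
  Literature.NumberTheory.EllipticCurves.ModularForms Literature.NumberTheory.DiophantineGeometry
  IsDiscreteValuationRing

namespace Summit.BirchSwinnertonDyer.BirchSwinnertonDyer.Theorems.AdditiveKoly.SemistabilityDefect

/-! ## §1 The dichotomy with the sketch's binder `e ∤ p − 1` / `e ∣ p − 1`, even `d_{K′}` -/

section EvenDefect

variable {p : ℕ} [Fact p.Prime]

/-- **THE RAMIFIED-HABITAT SIGN LAW, EVEN `d_{K′}` — supercuspidal half, with the sketch's binder `e ∤ p − 1`,
`e := W.semistabilityDefectAt p`.** `E/ℚ` elliptic, `N_E = M p²` (`p ≥ 5`, `M` squarefree, `p ∤ M`), additive potentially good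
at `p` with `ord_pΔ_min = a ∈ {2,3,4,8,9,10}` (every potentially good row except I₀*), `K′` imaginary quadratic with
`4 ∣ d_{K′}`, `p ∣ d_{K′}`, every prime of `M` split. If `¬ W.semistabilityDefectAt p ∣ p − 1` then `w(E)·w(E^{(d_{K′})}) = +1`
(Serre: `e = 12/gcd(12,a)`, `semistabilityDefectAt_eq_twelve_div_gcd_of_addVal_eq`). CONDITIONAL on {`hmod`, F1 at `p`};
BSD is not proved by this. [cite: Serre1972, §5.6 (p. 312)] [cite: Rohrlich1993Compositio, Prop. 2(iv)] [cite: KellockDokchitser2023, Rem. 2.2] -/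
theorem rootNumber_mul_rootNumber_twist_discr_even_eq_one_of_not_semistabilityDefectAt_dvd
    (W : WeierstrassCurve ℚ) [W.IsElliptic]
    (hmod : exists_isNewformOf) (hF1 : W.atkinLehnerEigenvalueAt_eq_localRootNumberAt)
    (hF1' : (W.quadraticTwist (((-1 : ℤ) ^ (p / 2) * p : ℤ) : ℚ)).atkinLehnerEigenvalueAt_eq_localRootNumberAt)
    (hp5 : 5 ≤ p) {M : ℕ} (hN : W.conductorNorm ℤ = M * p ^ 2) (hM : Squarefree M) (hpM : ¬ p ∣ M) {a : ℕ}
    (hΔ : addVal ℤ_[p] (((W.baseChange ℚ_[p]).minimal ℤ_[p]).integralModel ℤ_[p]).Δ = a)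
    (ha : a = 2 ∨ a = 3 ∨ a = 4 ∨ a = 8 ∨ a = 9 ∨ a = 10)
    (hc₄ : addVal ℤ_[p] (((W.baseChange ℚ_[p]).minimal ℤ_[p]).integralModel ℤ_[p]).c₄ ≠ 0)
    (hj : ¬ 3 * addVal ℤ_[p] (((W.baseChange ℚ_[p]).minimal ℤ_[p]).integralModel ℤ_[p]).c₄ <
      addVal ℤ_[p] (((W.baseChange ℚ_[p]).minimal ℤ_[p]).integralModel ℤ_[p]).Δ)
    (K : Type) [Field K] [NumberField K] (hK : IsImaginaryQuadratic K) (h4K : 4 ∣ NumberField.discr K)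
    (hpd : (p : ℤ) ∣ NumberField.discr K)
    (hodd : ∀ q ∈ M.primeFactors, q ≠ 2 → J(NumberField.discr K | q) = 1)
    (htwo : 2 ∣ M → NumberField.discr K % 8 = 1)
    (hsc : ¬ W.semistabilityDefectAt p ∣ p - 1) :
    W.rootNumber * (W.quadraticTwist (NumberField.discr K : ℚ)).rootNumber = 1 := by
  rw [W.semistabilityDefectAt_eq_twelve_div_gcd_of_addVal_eq hp5 hΔ hj] at hsc
  rcases ha with h | h | h | h | h | h
  · exact RamifiedHabitat.rootNumber_mul_rootNumber_twist_discr_even_eq_one_of_not_dvd W hmod hF1 hF1' hp5 hN hpM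
      hΔ (Or.inl h) hc₄ hj K hK h4K hpd hodd htwo hsc
  · exact RamifiedHabitat.rootNumber_mul_rootNumber_twist_discr_even_eq_one_of_not_dvd W hmod hF1 hF1' hp5 hN hpM
      hΔ (Or.inr (Or.inl h)) hc₄ hj K hK h4K hpd hodd htwo hsc
  · exact RamifiedHabitat.rootNumber_mul_rootNumber_twist_discr_even_eq_one_of_not_dvd W hmod hF1 hF1' hp5 hN hpM
      hΔ (Or.inr (Or.inr h)) hc₄ hj K hK h4K hpd hodd htwo hsc
  · exact RamifiedHabitat.rootNumber_mul_rootNumber_twist_discr_even_of_ge_eq_one_of_not_dvd W hmod hF1 hF1' hp5 hN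
      hM hpM hΔ (Or.inl h) hc₄ hj K hK h4K hpd hodd htwo hsc
  · exact RamifiedHabitat.rootNumber_mul_rootNumber_twist_discr_even_of_ge_eq_one_of_not_dvd W hmod hF1 hF1' hp5 hN
      hM hpM hΔ (Or.inr (Or.inl h)) hc₄ hj K hK h4K hpd hodd htwo hsc
  · exact RamifiedHabitat.rootNumber_mul_rootNumber_twist_discr_even_of_ge_eq_one_of_not_dvd W hmod hF1 hF1' hp5 hN
      hM hpM hΔ (Or.inr (Or.inr h)) hc₄ hj K hK h4K hpd hodd htwo hsc

/-- **EVEN `d_{K′}` — principal-series half with the sketch's binder `e ∣ p − 1`** (same rows; potentially good):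
`w(E)·w(E^{(d_{K′})}) = −1`. CONDITIONAL on {`hmod`, F1 at `p`}; BSD is not proved by this.
[cite: Serre1972, §5.6 (p. 312)] [cite: Rohrlich1993Compositio, Prop. 2(iv)] [cite: KellockDokchitser2023, Rem. 2.2] -/
theorem rootNumber_mul_rootNumber_twist_discr_even_eq_neg_one_of_semistabilityDefectAt_dvd
    (W : WeierstrassCurve ℚ) [W.IsElliptic]
    (hmod : exists_isNewformOf) (hF1 : W.atkinLehnerEigenvalueAt_eq_localRootNumberAt)
    (hF1' : (W.quadraticTwist (((-1 : ℤ) ^ (p / 2) * p : ℤ) : ℚ)).atkinLehnerEigenvalueAt_eq_localRootNumberAt)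
    (hp5 : 5 ≤ p) {M : ℕ} (hN : W.conductorNorm ℤ = M * p ^ 2) (hM : Squarefree M) (hpM : ¬ p ∣ M) {a : ℕ}
    (hΔ : addVal ℤ_[p] (((W.baseChange ℚ_[p]).minimal ℤ_[p]).integralModel ℤ_[p]).Δ = a)
    (ha : a = 2 ∨ a = 3 ∨ a = 4 ∨ a = 8 ∨ a = 9 ∨ a = 10)
    (hc₄ : addVal ℤ_[p] (((W.baseChange ℚ_[p]).minimal ℤ_[p]).integralModel ℤ_[p]).c₄ ≠ 0)
    (hj : ¬ 3 * addVal ℤ_[p] (((W.baseChange ℚ_[p]).minimal ℤ_[p]).integralModel ℤ_[p]).c₄ <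
      addVal ℤ_[p] (((W.baseChange ℚ_[p]).minimal ℤ_[p]).integralModel ℤ_[p]).Δ)
    (K : Type) [Field K] [NumberField K] (hK : IsImaginaryQuadratic K) (h4K : 4 ∣ NumberField.discr K)
    (hpd : (p : ℤ) ∣ NumberField.discr K)
    (hodd : ∀ q ∈ M.primeFactors, q ≠ 2 → J(NumberField.discr K | q) = 1)
    (htwo : 2 ∣ M → NumberField.discr K % 8 = 1)
    (hps : W.semistabilityDefectAt p ∣ p - 1) :
    W.rootNumber * (W.quadraticTwist (NumberField.discr K : ℚ)).rootNumber = -1 := by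
  rw [W.semistabilityDefectAt_eq_twelve_div_gcd_of_addVal_eq hp5 hΔ hj] at hps
  rcases ha with h | h | h | h | h | h
  · exact RamifiedHabitat.rootNumber_mul_rootNumber_twist_discr_even_eq_neg_one_of_dvd W hmod hF1 hF1' hp5 hN hpM
      hΔ (Or.inl h) hc₄ hj K hK h4K hpd hodd htwo hps
  · exact RamifiedHabitat.rootNumber_mul_rootNumber_twist_discr_even_eq_neg_one_of_dvd W hmod hF1 hF1' hp5 hN hpM
      hΔ (Or.inr (Or.inl h)) hc₄ hj K hK h4K hpd hodd htwo hps
  · exact RamifiedHabitat.rootNumber_mul_rootNumber_twist_discr_even_eq_neg_one_of_dvd W hmod hF1 hF1' hp5 hN hpM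
      hΔ (Or.inr (Or.inr h)) hc₄ hj K hK h4K hpd hodd htwo hps
  · exact RamifiedHabitat.rootNumber_mul_rootNumber_twist_discr_even_of_ge_eq_neg_one_of_dvd W hmod hF1 hF1' hp5 hN
      hM hpM hΔ (Or.inl h) hc₄ hj K hK h4K hpd hodd htwo hps
  · exact RamifiedHabitat.rootNumber_mul_rootNumber_twist_discr_even_of_ge_eq_neg_one_of_dvd W hmod hF1 hF1' hp5 hN
      hM hpM hΔ (Or.inr (Or.inl h)) hc₄ hj K hK h4K hpd hodd htwo hps
  · exact RamifiedHabitat.rootNumber_mul_rootNumber_twist_discr_even_of_ge_eq_neg_one_of_dvd W hmod hF1 hF1' hp5 hN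
      hM hpM hΔ (Or.inr (Or.inr h)) hc₄ hj K hK h4K hpd hodd htwo hps

end EvenDefect

/-! ## §2 The card's sign laws AS TYPED for `4 ∣ d_{K′}`, and §3 with no parity binder -/

section AllDiscr

variable {p : ℕ} [Fact p.Prime]

omit [Fact p.Prime] in
/-- From the sketch's `OtherBadPrimesSplit W p d` (read on `N = M·p²`) to the sign-law files' `hodd`, `htwo` (as in
`…SignLawAsTyped`). [folklore] -/
private theorem split_data_of_otherBadPrimesSplit' (W : WeierstrassCurve ℚ) {M : ℕ}
    (hN : W.conductorNorm ℤ = M * p ^ 2) (hpM : ¬ p ∣ M) {d : ℤ}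
    (hsplit : ∀ q : ℕ, q.Prime → (q : ℤ) ∣ (W.conductorNorm ℤ : ℤ) → q ≠ p →
      (q ≠ 2 → J(d | q) = 1) ∧ (q = 2 → d % 8 = 1)) :
    (∀ q ∈ M.primeFactors, q ≠ 2 → J(d | q) = 1) ∧ (2 ∣ M → d % 8 = 1) := by
  have hdvdN : ∀ q : ℕ, q ∣ M → (q : ℤ) ∣ (W.conductorNorm ℤ : ℤ) := fun q hq ↦ by
    rw [hN]; exact_mod_cast dvd_mul_of_dvd_left hq (p ^ 2)
  have hne : ∀ q : ℕ, q ∣ M → q ≠ p := fun q hq h ↦ hpM (h ▸ hq)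
  refine ⟨fun q hq hq2 ↦ ?_, fun h2M ↦ ?_⟩
  · exact (hsplit q (Nat.prime_of_mem_primeFactors hq) (hdvdN q (Nat.dvd_of_mem_primeFactors hq))
      (hne q (Nat.dvd_of_mem_primeFactors hq))).1 hq2
  · exact (hsplit 2 Nat.prime_two (hdvdN 2 h2M) (hne 2 h2M)).2 rfl

/-- The exponent `a = ord Δ(X)` of the chosen `ℤ_p`-minimal model at an additive potentially good `p ≥ 5` is a natural number in Serre's
table `{2,3,4,6,8,9,10}` (plumbing shared by the AS-TYPED theorems). [folklore] -/
private theorem addVal_data_of_addv (W : WeierstrassCurve ℚ) [W.IsElliptic] (hp5 : 5 ≤ p) (hadd : Addv W p)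
    (hjQ : 0 ≤ padicValRat p W.j) :
    ∃ a : ℕ, addVal ℤ_[p] (((W.baseChange ℚ_[p]).minimal ℤ_[p]).integralModel ℤ_[p]).Δ = a ∧
      (a = 2 ∨ a = 3 ∨ a = 4 ∨ a = 6 ∨ a = 8 ∨ a = 9 ∨ a = 10) ∧
      addVal ℤ_[p] (((W.baseChange ℚ_[p]).minimal ℤ_[p]).integralModel ℤ_[p]).c₄ ≠ 0 ∧
      ¬ 3 * addVal ℤ_[p] (((W.baseChange ℚ_[p]).minimal ℤ_[p]).integralModel ℤ_[p]).c₄ <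
        addVal ℤ_[p] (((W.baseChange ℚ_[p]).minimal ℤ_[p]).integralModel ℤ_[p]).Δ := by
  have haddX := W.hasAdditiveReduction_minimal_padic_of_not_good_of_not_mult hadd.1 hadd.2
  obtain ⟨hc₄, -⟩ := W.addVal_ne_zero_of_hasAdditiveReduction_minimal_padic haddX
  have hj := (W.padicValRat_j_nonneg_iff_not_addVal_lt).mp hjQ
  set a : ℕ := (addVal ℤ_[p] (((W.baseChange ℚ_[p]).minimal ℤ_[p]).integralModel ℤ_[p]).Δ).toNat with ha
  have hmem := W.toNat_addVal_Δ_minimal_padic_mem_of_hasAdditiveReduction hp5 haddX hj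
  have htop : addVal ℤ_[p] (((W.baseChange ℚ_[p]).minimal ℤ_[p]).integralModel ℤ_[p]).Δ ≠ ⊤ := by
    intro h
    rw [h] at hmem
    simp at hmem
  have hΔ : addVal ℤ_[p] (((W.baseChange ℚ_[p]).minimal ℤ_[p]).integralModel ℤ_[p]).Δ = a := by
    rw [ha, ENat.coe_toNat htop]
  rw [← ha] at hmem
  exact ⟨a, hΔ, hmem, hc₄, hj⟩

/-- **`SignLawSupercuspidal` AS TYPED for EVEN `d_{K′}`** (`4 ∣ d_{K′}`), on `E` semistable away from `p`: hypotheses in the sketch's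
shape — `p ≥ 5`, `Addv W p`, `¬ W.semistabilityDefectAt p ∣ p − 1`, `K′` imaginary quadratic, `p ∣ d_{K′}`, `OtherBadPrimesSplit W p d_{K′}`
(unfolded) — plus `N_E = M·p²` with `M` squarefree, `hmod`, `hF1`, `hF1'`. CONCLUSION `w(E)·w(E^{(d_{K′})}) = +1`. Chain as in the odd
case (`signLawSupercuspidal_of_addv_of_squarefree`): `Addv` ⟹ additive minimal model; `¬ e ∣ p − 1` ⟹ potentially good and `a ≠ 6`;
Serre's table; §1. BSD is not proved by this. [cite: Serre1972, §5.6 (p. 312)] [cite: Rohrlich1993Compositio, Prop. 2(iv)]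
[cite: KellockDokchitser2023, Rem. 2.2] -/
theorem signLawSupercuspidal_of_addv_of_squarefree_of_four_dvd (W : WeierstrassCurve ℚ) [W.IsElliptic]
    (hmod : exists_isNewformOf) (hF1 : W.atkinLehnerEigenvalueAt_eq_localRootNumberAt)
    (hF1' : (W.quadraticTwist (((-1 : ℤ) ^ (p / 2) * p : ℤ) : ℚ)).atkinLehnerEigenvalueAt_eq_localRootNumberAt)
    (hp5 : 5 ≤ p) (hadd : Addv W p) (hsc : ¬ W.semistabilityDefectAt p ∣ p - 1)
    {M : ℕ} (hN : W.conductorNorm ℤ = M * p ^ 2) (hM : Squarefree M) (hpM : ¬ p ∣ M)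
    (K : Type) [Field K] [NumberField K] (hK : IsImaginaryQuadratic K) (h4K : 4 ∣ NumberField.discr K)
    (hpd : (p : ℤ) ∣ NumberField.discr K)
    (hsplit : ∀ q : ℕ, q.Prime → (q : ℤ) ∣ (W.conductorNorm ℤ : ℤ) → q ≠ p →
      (q ≠ 2 → J(NumberField.discr K | q) = 1) ∧ (q = 2 → NumberField.discr K % 8 = 1)) :
    W.rootNumber * (W.quadraticTwist (NumberField.discr K : ℚ)).rootNumber = 1 := by
  have hp : p.Prime := Fact.out
  have hjQ : 0 ≤ padicValRat p W.j :=
    W.padicValRat_j_nonneg_of_not_semistabilityDefectAt_dvd hp5 hadd.1 hadd.2 hsc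
  obtain ⟨a, hΔ, hmem, hc₄, hj⟩ := addVal_data_of_addv W hp5 hadd hjQ
  obtain ⟨hodd, htwo⟩ := split_data_of_otherBadPrimesSplit' W hN hpM hsplit
  -- `a = 6` (type I₀*, `e = 2 ∣ p − 1`) is excluded by `hsc`
  have hne6 : a ≠ 6 := by
    intro h6
    apply hsc
    rw [W.semistabilityDefectAt_eq_twelve_div_gcd_of_addVal_eq hp5 hΔ hj, h6]
    have : 12 / Nat.gcd 6 12 = 2 := by decide
    rw [this]
    rcases hp.eq_two_or_odd with h | h <;> omega
  have ha' : a = 2 ∨ a = 3 ∨ a = 4 ∨ a = 8 ∨ a = 9 ∨ a = 10 := by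
    rcases hmem with h | h | h | h | h | h | h
    · exact Or.inl h
    · exact Or.inr (Or.inl h)
    · exact Or.inr (Or.inr (Or.inl h))
    · exact absurd h hne6
    · exact Or.inr (Or.inr (Or.inr (Or.inl h)))
    · exact Or.inr (Or.inr (Or.inr (Or.inr (Or.inl h))))
    · exact Or.inr (Or.inr (Or.inr (Or.inr (Or.inr h))))
  exact rootNumber_mul_rootNumber_twist_discr_even_eq_one_of_not_semistabilityDefectAt_dvd W hmod hF1 hF1' hp5 hN hM
    hpM hΔ ha' hc₄ hj K hK h4K hpd hodd htwo hsc

/-- **`SignLawPrincipalSeries` AS TYPED on the POTENTIALLY GOOD rows for EVEN `d_{K′}`**: the sketch's binders plus `0 ≤ ord_p j`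
(the sketch's Prop lacks it and is false on the potentially multiplicative rows, evidence #41), `N_E = M·p²` with `M` squarefree, `hmod`;
F1 at `p` is used on types II/III/IV/IV*/III*/II* and NOT on I₀* (`…ramifiedTwist_even_of_six`). CONCLUSION `w(E)·w(E^{(d_{K′})}) = −1`.
BSD is not proved by this. [cite: Serre1972, §5.6 (p. 312)] [cite: Rohrlich1993Compositio, Prop. 2(iv)] [cite: KellockDokchitser2023, Rem. 2.2] -/
theorem signLawPrincipalSeries_of_addv_of_padicValRat_j_nonneg_of_squarefree_of_four_dvd (W : WeierstrassCurve ℚ)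
    [W.IsElliptic] (hmod : exists_isNewformOf) (hF1 : W.atkinLehnerEigenvalueAt_eq_localRootNumberAt)
    (hF1' : (W.quadraticTwist (((-1 : ℤ) ^ (p / 2) * p : ℤ) : ℚ)).atkinLehnerEigenvalueAt_eq_localRootNumberAt)
    (hp5 : 5 ≤ p) (hadd : Addv W p) (hjQ : 0 ≤ padicValRat p W.j) (hps : W.semistabilityDefectAt p ∣ p - 1)
    {M : ℕ} (hN : W.conductorNorm ℤ = M * p ^ 2) (hM : Squarefree M) (hpM : ¬ p ∣ M)
    (K : Type) [Field K] [NumberField K] (hK : IsImaginaryQuadratic K) (h4K : 4 ∣ NumberField.discr K)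
    (hpd : (p : ℤ) ∣ NumberField.discr K)
    (hsplit : ∀ q : ℕ, q.Prime → (q : ℤ) ∣ (W.conductorNorm ℤ : ℤ) → q ≠ p →
      (q ≠ 2 → J(NumberField.discr K | q) = 1) ∧ (q = 2 → NumberField.discr K % 8 = 1)) :
    W.rootNumber * (W.quadraticTwist (NumberField.discr K : ℚ)).rootNumber = -1 := by
  have hp : p.Prime := Fact.out
  obtain ⟨a, hΔ, hmem, hc₄, hj⟩ := addVal_data_of_addv W hp5 hadd hjQ
  obtain ⟨hodd, htwo⟩ := split_data_of_otherBadPrimesSplit' W hN hpM hsplit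
  by_cases h6 : a = 6
  · -- type I₀*: `hmod` alone
    rw [h6] at hΔ
    exact RamifiedHabitat.rootNumber_mul_rootNumber_twist_discr_even_of_six W hmod hp5 hN hM hpM hΔ hc₄ hj K hK h4K hpd
      hodd htwo
  · have ha' : a = 2 ∨ a = 3 ∨ a = 4 ∨ a = 8 ∨ a = 9 ∨ a = 10 := by
      rcases hmem with h | h | h | h | h | h | h
      · exact Or.inl h
      · exact Or.inr (Or.inl h)
      · exact Or.inr (Or.inr (Or.inl h))
      · exact absurd h h6
      · exact Or.inr (Or.inr (Or.inr (Or.inl h)))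
      · exact Or.inr (Or.inr (Or.inr (Or.inr (Or.inl h))))
      · exact Or.inr (Or.inr (Or.inr (Or.inr (Or.inr h))))
    exact rootNumber_mul_rootNumber_twist_discr_even_eq_neg_one_of_semistabilityDefectAt_dvd W hmod hF1 hF1' hp5 hN
      hM hpM hΔ ha' hc₄ hj K hK h4K hpd hodd htwo hps

/-- **`SignLawSupercuspidal` AS TYPED, EVERY `d_{K′}` (no parity binder), on `E` semistable away from `p`.** Hypotheses IN THE
SKETCH'S SHAPE (`RamifiedHabitatKuriharaSlotSketch.lean` §1 `RamifiedToricHabitat.SignLawSupercuspidal`): `p ≥ 5`, `Addv W p`,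
`¬ W.semistabilityDefectAt p ∣ p − 1`, `K′` imaginary quadratic, `p ∣ d_{K′}`, `OtherBadPrimesSplit W p d_{K′}` (unfolded verbatim);
PLUS `N_E = M·p²` with `M` squarefree and the named facts `hmod` (Modularity), `hF1`, `hF1'` (Kellock–Dokchitser Rem. 2.2 at `p` for
`E`, `E^{(p*)}`). CONCLUSION `w(E)·w(E^{(d_{K′})}) = +1`. The sketch's `1 < e` and `d_{K′} < −4` are not needed. A quadratic
discriminant is `≡ 1 (4)` (odd: w3 g12's `signLawSupercuspidal_of_addv_of_squarefree`) or divisible by `4` (§2).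
BSD is not proved by this; KS′/KPA′ stay open. [cite: Serre1972, §5.6 (p. 312)] [cite: Rohrlich1993Compositio, Prop. 2(iv)]
[cite: KellockDokchitser2023, Rem. 2.2] -/
theorem signLawSupercuspidal_of_addv_of_squarefree_allDiscr (W : WeierstrassCurve ℚ) [W.IsElliptic]
    (hmod : exists_isNewformOf) (hF1 : W.atkinLehnerEigenvalueAt_eq_localRootNumberAt)
    (hF1' : (W.quadraticTwist (((-1 : ℤ) ^ (p / 2) * p : ℤ) : ℚ)).atkinLehnerEigenvalueAt_eq_localRootNumberAt)
    (hp5 : 5 ≤ p) (hadd : Addv W p) (hsc : ¬ W.semistabilityDefectAt p ∣ p - 1)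
    {M : ℕ} (hN : W.conductorNorm ℤ = M * p ^ 2) (hM : Squarefree M) (hpM : ¬ p ∣ M)
    (K : Type) [Field K] [NumberField K] (hK : IsImaginaryQuadratic K) (hpd : (p : ℤ) ∣ NumberField.discr K)
    (hsplit : ∀ q : ℕ, q.Prime → (q : ℤ) ∣ (W.conductorNorm ℤ : ℤ) → q ≠ p →
      (q ≠ 2 → J(NumberField.discr K | q) = 1) ∧ (q = 2 → NumberField.discr K % 8 = 1)) :
    W.rootNumber * (W.quadraticTwist (NumberField.discr K : ℚ)).rootNumber = 1 := by
  rcases Literature.NumberTheory.QuadraticFields.Quadratic.isFundamentalDiscriminant_discr (K := K) hK.1 with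
    ⟨h1, -, -⟩ | ⟨h4, -, -⟩
  · exact signLawSupercuspidal_of_addv_of_squarefree W hmod hF1 hF1' hp5 hadd hsc hN hM hpM K hK
      (Int.odd_iff.mpr (by omega)) hpd hsplit
  · exact signLawSupercuspidal_of_addv_of_squarefree_of_four_dvd W hmod hF1 hF1' hp5 hadd hsc hN hM hpM K hK h4 hpd hsplit

/-- **`SignLawPrincipalSeries` AS TYPED on the POTENTIALLY GOOD rows, EVERY `d_{K′}` (no parity binder)**, `E` semistable away from `p`:
the sketch's binders (`p ≥ 5`, `Addv W p`, `W.semistabilityDefectAt p ∣ p − 1`, `p ∣ d_{K′}`, `OtherBadPrimesSplit`) PLUS `0 ≤ ord_p j`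
(potentially good — false without it on the potentially multiplicative rows, evidence #41), `N_E = M·p²` with `M` squarefree, `hmod`;
`hF1`, `hF1'` used except on I₀*. CONCLUSION `w(E)·w(E^{(d_{K′})}) = −1`. BSD is not proved by this.
[cite: Serre1972, §5.6 (p. 312)] [cite: Rohrlich1993Compositio, Prop. 2(iv)] [cite: KellockDokchitser2023, Rem. 2.2] -/
theorem signLawPrincipalSeries_of_addv_of_padicValRat_j_nonneg_of_squarefree_allDiscr (W : WeierstrassCurve ℚ)
    [W.IsElliptic] (hmod : exists_isNewformOf) (hF1 : W.atkinLehnerEigenvalueAt_eq_localRootNumberAt)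
    (hF1' : (W.quadraticTwist (((-1 : ℤ) ^ (p / 2) * p : ℤ) : ℚ)).atkinLehnerEigenvalueAt_eq_localRootNumberAt)
    (hp5 : 5 ≤ p) (hadd : Addv W p) (hjQ : 0 ≤ padicValRat p W.j) (hps : W.semistabilityDefectAt p ∣ p - 1)
    {M : ℕ} (hN : W.conductorNorm ℤ = M * p ^ 2) (hM : Squarefree M) (hpM : ¬ p ∣ M)
    (K : Type) [Field K] [NumberField K] (hK : IsImaginaryQuadratic K) (hpd : (p : ℤ) ∣ NumberField.discr K)
    (hsplit : ∀ q : ℕ, q.Prime → (q : ℤ) ∣ (W.conductorNorm ℤ : ℤ) → q ≠ p →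
      (q ≠ 2 → J(NumberField.discr K | q) = 1) ∧ (q = 2 → NumberField.discr K % 8 = 1)) :
    W.rootNumber * (W.quadraticTwist (NumberField.discr K : ℚ)).rootNumber = -1 := by
  rcases Literature.NumberTheory.QuadraticFields.Quadratic.isFundamentalDiscriminant_discr (K := K) hK.1 with
    ⟨h1, -, -⟩ | ⟨h4, -, -⟩
  · exact signLawPrincipalSeries_of_addv_of_padicValRat_j_nonneg_of_squarefree W hmod hF1 hF1' hp5 hadd hjQ hps hN hM hpM K hK
      (Int.odd_iff.mpr (by omega)) hpd hsplit
  · exact signLawPrincipalSeries_of_addv_of_padicValRat_j_nonneg_of_squarefree_of_four_dvd W hmod hF1 hF1' hp5 hadd hjQ hps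
      hN hM hpM K hK h4 hpd hsplit

end AllDiscr

end Summit.BirchSwinnertonDyer.BirchSwinnertonDyer.Theorems.AdditiveKoly.SemistabilityDefect

end
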